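import Summits.BirchSwinnertonDyer.Rank1Residual.AdditivePotMult.TwistDescent
import HarnessLib

/-!
# Normalising the topological generator into `Gal(ℚ̄/K)` — a prerequisite of kernel brick 5 of the transport [C] (cell `b2b-bsdres`, seat additive-p1, gen 8)

HONEST FRAMING (cell `b2b-bsdres`, run/shared/lean/b2b/bsd-rank1-residual/, verbatim in every
file): the goal of the cell is to DELETE the COMBINATION-SHAPED residual classes of the
Birch–Swinnerton-Dyer formula for ALL analytic-rank `≤ 1` elliptic curves over `ℚ` — "full BSD
formula for every rank `≤ 1` curve in class `C`" assembled STRICTLY from published theorems — so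
that the rank-`≤ 1` remainder becomes exactly the CONSTRUCTION-SHAPED classes, which are TYPED
(missing-input `Prop`s), NOT attempted. This is not "finishing BSD". The additive sub-cell (seats
additive-p1…p4) is a RESEARCH ROUTE on the construction-shaped classes X3/X4; sub-cell additive-p1
= the potentially MULTIPLICATIVE additive prime (X3♯(M) / X4(M)); no claim beyond the stated
classes; the labels of X3/X4 are UNCHANGED by this file; nothing is booked.

One definition (a re-labelling of a hypothesis structure along an equality of actions; no
predicate, no named fact) and theorems. Context: design HOME/b2b-bsdres-additive-p1/KERNEL-C-P3.md,
brick 5. The typed input `ChiBranchLeadingTerm[Odd]At W p` quantifies over ALL topological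
generators `γ` with `IsCyclotomicVariable p γ` — which allows `γ` to act non-trivially on `μ_p`,
hence on `K = ℚ(√p*)` — whereas the transport of dual data along [C]
(`SelmerDualData.toChiEigen`, file `ChiEigenSelmerDual`) wants `γ ∈ Gal(ℚ̄/K)`. This file removes
the discrepancy:

* `conjH1_mul_of_mem_kerSubgroup` — on `H¹(ℚ_∞, E[p^∞])` the conjugation by `γ g₀` equals that by
  `γ` for `g₀ ∈ Gal(ℚ̄/ℚ_∞) = ker κ` (inner automorphisms act trivially);
* `SelmerDualData.congrGen` — hence a `Λ`-dual datum for `(κ, γ)` IS one for `(κ, γ g₀)` with the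
  same module, and `κ (γ g₀) = κ γ` (`isTopGenerator_mul_of_mem_kerSubgroup`);
* `not_kerSubgroup_le_of_index_two` — for `p` odd, `Gal(ℚ̄/ℚ_∞)` is contained in NO subgroup of
  index `2` (its image `ℤ_p` has no index-`2` subgroup: `2 ∈ ℤ_pˣ`), in particular not in
  `Gal(ℚ̄/K)`; so `exists_mul_mem_galRange`: some `g₀ ∈ ker κ` has `γ g₀ ∈ Gal(ℚ̄/K)`.

References: J.-P. Serre, *Local Fields*, VII.§5 Prop. 3 (inner automorphisms act trivially on
cohomology) [SerreLocalFields1979]; L. Washington, *Introduction to Cyclotomic Fields*, §13.1.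
-/

noncomputable section

open scoped Classical

namespace Summit.BirchSwinnertonDyer.Rank1Residual.AdditivePotMult

open Literature.NumberTheory.EllipticCurves Literature.NumberTheory.GaloisRepresentations
  WeierstrassCurve

/-! ## §1 Changing the generator by an element of `ker κ` -/

section Gen

variable {K : Type} [Field K] [NumberField K] (W : WeierstrassCurve K) {p : ℕ} [Fact p.Prime]
  (κ : ZpExtension K p)

omit [NumberField K] in
/-- Conjugation by `γ g₀`, `g₀ ∈ ker κ`, equals conjugation by `γ` on `H¹(K_∞, E[p^∞])`
(`(γ g₀)_* = γ_* ∘ g₀_*` and `g₀_* = id`). Serre, *Local Fields*, VII.§5 Prop. 3.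
[cite: SerreLocalFields1979, VII.§5 Prop. 3] -/
theorem conjH1_mul_of_mem_kerSubgroup (γ : Field.absoluteGaloisGroup K)
    {g₀ : Field.absoluteGaloisGroup K} (hg₀ : g₀ ∈ κ.kerSubgroup) :
    W.conjH1 p κ.kerSubgroup (γ * g₀) = W.conjH1 p κ.kerSubgroup γ := by
  rw [W.conjH1_mul_holds p κ.kerSubgroup, W.conjH1_of_mem_holds p κ.kerSubgroup hg₀,
    AddMonoidHom.comp_id]

omit [NumberField K] in
/-- `κ (γ g₀) = κ γ` for `g₀ ∈ ker κ`; in particular `γ g₀` is a topological generator iff `γ` is.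
[folklore] -/
theorem isTopGenerator_mul_of_mem_kerSubgroup {γ g₀ : Field.absoluteGaloisGroup K}
    (hγ : κ.IsTopGenerator γ) (hg₀ : g₀ ∈ κ.kerSubgroup) : κ.IsTopGenerator (γ * g₀) := by
  rw [ZpExtension.IsTopGenerator, map_mul, ZpExtension.mem_kerSubgroup.mp hg₀, mul_one]
  exact hγ

/-- **Re-labelling a `Λ`-dual datum along an equality of conjugation actions**: if
`γ'_* = γ_*` on `H¹(K_∞, E[p^∞])` then a `SelmerDualData W κ γ` is a `SelmerDualData W κ γ'` with
the SAME module, map and identities. [folklore] -/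
def SelmerDualData.congrGen {γ γ' : Field.absoluteGaloisGroup K}
    (h : W.conjH1 p κ.kerSubgroup γ' = W.conjH1 p κ.kerSubgroup γ) (D : W.SelmerDualData κ γ) :
    W.SelmerDualData κ γ' where
  X := D.X
  conj_mem := fun s hs ↦ by rw [h]; exact D.conj_mem s hs
  toDual := D.toDual
  bijective := D.bijective
  toDual_T_smul := fun x s ↦ by
    rw [D.toDual_T_smul]
    congr 2
    apply Subtype.ext
    change W.conjH1 p κ.kerSubgroup γ s = W.conjH1 p κ.kerSubgroup γ' s
    rw [h]
  toDual_C_smul := D.toDual_C_smul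

/-- The re-labelled datum has the same module. [folklore] -/
theorem SelmerDualData.congrGen_X {γ γ' : Field.absoluteGaloisGroup K}
    (h : W.conjH1 p κ.kerSubgroup γ' = W.conjH1 p κ.kerSubgroup γ) (D : W.SelmerDualData κ γ) :
    (SelmerDualData.congrGen W κ h D).X = D.X :=
  rfl

/-- Same characteristic ideal. [folklore] -/
theorem SelmerDualData.charIdeal_congrGen {γ γ' : Field.absoluteGaloisGroup K}
    (h : W.conjH1 p κ.kerSubgroup γ' = W.conjH1 p κ.kerSubgroup γ) (D : W.SelmerDualData κ γ) :
    (SelmerDualData.congrGen W κ h D).charIdeal = D.charIdeal :=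
  rfl

/-- Same torsion-ness. [folklore] -/
theorem SelmerDualData.isTorsion_congrGen_iff {γ γ' : Field.absoluteGaloisGroup K}
    (h : W.conjH1 p κ.kerSubgroup γ' = W.conjH1 p κ.kerSubgroup γ) (D : W.SelmerDualData κ γ) :
    (SelmerDualData.congrGen W κ h D).IsTorsion ↔ D.IsTorsion :=
  Iff.rfl

end Gen

/-! ## §2 For `p` odd, `ker κ` lies in no subgroup of index `2` -/

section IndexTwo

variable {K : Type} [Field K] {p : ℕ} [Fact p.Prime] (κ : ZpExtension K p)

/-- A subgroup of (multiplicative) `ℤ_p` containing all squares is everything when `p` is odd: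
`x = (x/2)²` additively, `2 ∈ ℤ_pˣ`. [folklore] -/
theorem eq_top_of_forall_sq_mem (hp2 : p ≠ 2) (S : Subgroup (Multiplicative ℤ_[p]))
    (hS : ∀ x : Multiplicative ℤ_[p], x ^ 2 ∈ S) : S = ⊤ := by
  have h2 : IsUnit (2 : ℤ_[p]) := by
    have hcop : ¬p ∣ 2 := fun h ↦ hp2 ((Nat.prime_dvd_prime_iff_eq (Fact.out : p.Prime)
      Nat.prime_two).mp h)
    exact_mod_cast IwasawaDual.isUnit_natCast_padicInt (p := p) (e := 2) hcop
  obtain ⟨u, hu⟩ := h2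
  rw [eq_top_iff]
  intro x _
  have hx : x = (Multiplicative.ofAdd (((u⁻¹ : ℤ_[p]ˣ) : ℤ_[p]) * Multiplicative.toAdd x)) ^ 2 := by
    apply Multiplicative.toAdd.injective
    rw [toAdd_pow, toAdd_ofAdd, nsmul_eq_mul, Nat.cast_ofNat, ← mul_assoc, ← hu, Units.mul_inv,
      one_mul]
  rw [hx]
  exact hS _

/-- **For `p` odd, `Gal(K̄/K_∞) = ker κ` is contained in no subgroup of index `2`**: the image of
such a subgroup in `ℤ_p` would have index `2`, but `ℤ_p` has no index-`2` subgroup. (Field side: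
a `ℤ_p`-extension has no quadratic subextension; Washington, *Introduction to Cyclotomic
Fields*, §13.1.) [folklore] -/
theorem not_kerSubgroup_le_of_index_two (hp2 : p ≠ 2) {U : Subgroup (Field.absoluteGaloisGroup K)}
    (hU : U.index = 2) : ¬ κ.kerSubgroup ≤ U := by
  intro hle
  set f := κ.toContinuousMonoidHom.toMonoidHom with hf
  have hker : f.ker ≤ U := hle
  have hcomap : (U.map f).comap f = U := Subgroup.comap_map_eq_self hker
  have hidx : (U.map f).index = 2 := by
    rw [← Subgroup.index_comap_of_surjective (U.map f) κ.surjective, hcomap, hU]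
  have hsq : ∀ x : Multiplicative ℤ_[p], x ^ 2 ∈ U.map f := fun x ↦ by
    rw [← hidx]; exact Subgroup.pow_index_mem _ x
  have htop := eq_top_of_forall_sq_mem hp2 _ hsq
  rw [htop, Subgroup.index_top] at hidx
  exact absurd hidx (by norm_num)

/-- Hence, for `p` odd and `U` of index `2`, some `g₀ ∈ ker κ` lies outside `U`. [folklore] -/
theorem exists_mem_kerSubgroup_not_mem (hp2 : p ≠ 2) {U : Subgroup (Field.absoluteGaloisGroup K)}
    (hU : U.index = 2) : ∃ g₀ ∈ κ.kerSubgroup, g₀ ∉ U := by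
  by_contra h
  refine not_kerSubgroup_le_of_index_two κ hp2 hU fun g hg ↦ ?_
  by_contra hgU
  exact h ⟨g, hg, hgU⟩

end IndexTwo

/-! ## §3 Over `ℚ` with `K` quadratic: a generator inside `Gal(ℚ̄/K)` with the same action -/

section Quadratic

variable (W : WeierstrassCurve ℚ) (K : Type) [Field K] [NumberField K]
  (h2 : Module.finrank ℚ K = 2) {θ : K} {c : ℚ} (hθ : θ ∉ Set.range (algebraMap ℚ K))
  (hc : θ ^ 2 = algebraMap ℚ K c) {p : ℕ} [Fact p.Prime] (κ : ZpExtension ℚ p)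

include h2 hθ hc in
/-- **Generator normalisation**: for `p` odd and ANY `γ ∈ Γ_ℚ` there is `g₀ ∈ Gal(ℚ̄/ℚ_∞)` with
`γ g₀ ∈ Gal(ℚ̄/K)`; then `(γ g₀)_* = γ_*` on `H¹(ℚ_∞, E[p^∞])` and `κ(γ g₀) = κ γ`. So every
`W.SelmerDualData κ γ` is a `W.SelmerDualData κ γ'` with `γ' ∈ Gal(ℚ̄/K)`, `κ γ' = κ γ`, and the
same module (`SelmerDualData.congrGen`) — the input shape of `SelmerDualData.toChiEigen`.
[folklore] -/
theorem exists_mul_mem_galRange (hp2 : p ≠ 2) (γ : Field.absoluteGaloisGroup ℚ) :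
    ∃ g₀ ∈ κ.kerSubgroup, γ * g₀ ∈ galRange (K := ℚ) K ∧
      W.conjH1 p κ.kerSubgroup (γ * g₀) = W.conjH1 p κ.kerSubgroup γ ∧ κ (γ * g₀) = κ γ := by
  haveI : IsGalois ℚ K := isGalois_of_finrank_eq_two K h2
  by_cases hγ : γ ∈ galRange (K := ℚ) K
  · exact ⟨1, one_mem _, by rw [mul_one]; exact hγ, by rw [mul_one], by rw [mul_one]⟩
  · obtain ⟨g₀, hg₀, hg₀U⟩ := exists_mem_kerSubgroup_not_mem κ hp2
      (index_galRange K h2 (sigmaQ_ne_one K h2 hθ hc))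
    refine ⟨g₀, hg₀, ?_, conjH1_mul_of_mem_kerSubgroup W κ γ hg₀, ?_⟩
    · -- `γ ∉ U`, `g₀ ∉ U`, `[Γ : U] = 2` ⇒ `γ g₀ ∈ U`
      have hc₀ := xor_galRange K h2 (sigmaQ_ne_one K h2 hθ hc)
      -- write both as `u c₀`
      set c₀ := liftToAbsGal (K := ℚ) K (sigmaQ K h2 hθ hc)
      have h1 : γ * c₀⁻¹ ∈ galRange (K := ℚ) K := (hc₀ γ).or.resolve_right hγ
      have h3 : g₀ * c₀⁻¹ ∈ galRange (K := ℚ) K := (hc₀ g₀).or.resolve_right hg₀U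
      haveI := normal_galRange K h2 (sigmaQ_ne_one K h2 hθ hc)
      -- `γ g₀ = (γ c₀⁻¹) · c₀ (g₀ c₀⁻¹) c₀⁻¹ · c₀²`; use: c₀ (g₀ c₀⁻¹) c₀⁻¹ ∈ U (normal), c₀² ∈ U
      have h4 : c₀ * (g₀ * c₀⁻¹) * c₀⁻¹ ∈ galRange (K := ℚ) K :=
        Subgroup.Normal.conj_mem inferInstance _ h3 c₀
      have h5 : c₀ * c₀ ∈ galRange (K := ℚ) K := mul_self_mem_of_xor hc₀
      have : γ * g₀ = (γ * c₀⁻¹) * (c₀ * (g₀ * c₀⁻¹) * c₀⁻¹) * (c₀ * c₀) := by group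
      rw [this]
      exact mul_mem (mul_mem h1 h4) h5
    · rw [map_mul, ZpExtension.mem_kerSubgroup.mp hg₀, mul_one]

end Quadratic

end Summit.BirchSwinnertonDyer.Rank1Residual.AdditivePotMult

end
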